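import Mathlib
import Summits.Ventures.PercRepro2.Defs
import Summits.Ventures.PercRepro2.Independence
import Summits.Ventures.PercRepro2.Harris
import Summits.Ventures.PercRepro2.Graph
import Summits.Ventures.PercRepro2.Exploration
import Summits.Ventures.PercRepro2.Events
import Summits.Ventures.PercRepro2.FourFunctions
import Summits.Ventures.PercRepro2.Induced
import Summits.Ventures.PercRepro2.Frontier
import Summits.Ventures.PercRepro2.ObsIndependence
import Summits.Ventures.PercRepro2.BHK
import Summits.Ventures.PercRepro2.BHKEvents
import Summits.Ventures.PercRepro2.OrderPreservation
import Summits.Ventures.PercRepro2.OrderPreservationDual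
import Summits.Ventures.PercRepro2.VdBKahn
import Summits.Ventures.PercRepro2.BHKAvoid
import Summits.Ventures.PercRepro2.R2PrimeThreeReduction
import Summits.Ventures.PercRepro2.YBridge
import Summits.Ventures.PercRepro2.Yu1Functionals
import Summits.Ventures.PercRepro2.Yu1Events
import Summits.Ventures.PercRepro2.Yu1
import Summits.Ventures.PercRepro2.LBSplit
import Summits.Ventures.PercRepro2.YDelta
import Summits.Ventures.PercRepro2.YDeltaTools
import Summits.Ventures.PercRepro2.SD
import Summits.Ventures.PercRepro2.Threshold
import Summits.Ventures.PercRepro2.Lambda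
import Summits.Ventures.PercRepro2.LambdaTau
import Summits.Ventures.PercRepro2.LambdaSlack
import Summits.Ventures.PercRepro2.HF2
import Summits.Ventures.PercRepro2.Yu2
import Summits.Ventures.PercRepro2.N0
import Summits.Ventures.PercRepro2.Y
import Summits.Ventures.PercRepro2.ZDelta

/-!
# Expansions of the (ZΔ)-slack (blind cell PercRepro2, typer-1; lead g6 ADDENDUM 17 (1)(b), (8))

Two exact, kernel-checked expansions of `Z = (Yu1Δ)-slack + (Yu2Δ)-slack`:

* **`Z_six_bracket`** — the six-bracket form (★) of ADDENDUM 17 (8), cleared by `D = P(PD)`: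
  `Z = D · ( W [(g_l − s_H) + (g_h − s_L^h)] + gap · s_L^h − r_b (s_H − s_L3) − r_b^h (s_L^h − s_H3^h) )`
  with the light shares of `Threshold` (`s_H = P(o ∈ C_l | b ∈ C_h, R)`, `s_L3`, `g_l`) and the heavy
  shares = the same definitions with the roles of `a₁, a₂` swapped (`s_L^h = P(o ∈ C_h | b ∈ C_l, R_h)`,
  `s_H3^h = P(o ∈ C_h | b ∈ C_h, a₃ ∈ C_l, R_h)`, `g_h = P(o ∈ C_h | PD)`), `gap = P(a₂ ↔ b) − P(a₁ ↔ b)`.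
  (Needs the five conditioning masses `N_h, r_b, N_l^h, r_b^h, D ≠ 0`.)
* **`Z_location_cut`** — the a₃-location cut of ADDENDUM 17 (6): `Z = Z_0 + Z_h + Z_l` (PD-world /
  T-world / T′-world pieces `Z0`, `Zh`, `Zl`; a regrouping); the support rows `ZhNonneg` (row 2′Zh,
  `Z_h ≥ 0`) and `Z0ZhNonneg` (`Z_0 + Z_h ≥ 0`) with closures, `ZDelta_of_Z0Zh_Zl`; the dead rows
  `Z0a`, `ZhPrime`, `ZL` with `sigma_light_eq` (`σ_l = Z_0a + Z_h′`) and `Z_eq_ZL_add_ZhPrime`.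
* **`Z_two_root_decomp`** — the two-root covariance expansion, cleared by `P(R) P(R_h)`: each root's
  slack `E[1_o τ_x; R_x]` splits by `LambdaSlack.slack_decomp` into its BHK bracket
  `[E[1_o τ₀; R_x] P(R_x) − E[1_o; R_x] E[τ₀; R_x]]` (`≥ 0` by `bracket_nonneg` when `0 ≤ W_x`)
  and the signed term `(D − W_x)(P(R_x) A′_x − E[1_o; R_x] r_x)`; plus the gap term
  `D_h · gap · P(R) P(R_h)`.
-/

namespace Summit.Ventures.PercRepro2

open UnionCluster Yu1 Threshold

section SixBracket

variable {V : Type*} {E : Type*} [Fintype E] [DecidableEq E] [Fintype V] [DecidableEq V]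
  {R : Type*} [Field R] [LinearOrder R] [IsStrictOrderedRing R]

omit [Fintype V] [LinearOrder R] [IsStrictOrderedRing R] in
/-- `T_{h→l} − Δ_h = A_h − A′_h` in the (swapped) threshold vocabulary. -/
lemma Thl_sub_deltaH_eq (p : E → R) (ends : E → Sym2 V) (o a₁ a₂ a₃ b : V) :
    prob p (PDEvent ends a₁ a₂ a₃ ∩ connEvent ends a₂ o ∩ connEvent ends a₁ b) -
        deltaH p ends o a₁ a₂ a₃ b =
      massA p ends o a₂ a₁ a₃ b - massA' p ends o a₂ a₁ a₃ b := by
  have h := Tlh_sub_deltaL_eq p ends o a₂ a₁ a₃ b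
  rw [PDEvent_symm] at h
  exact h

omit [Fintype V] [LinearOrder R] [IsStrictOrderedRing R] in
/-- **The six-bracket form (★)** (ADDENDUM 17 (8)), cleared by `D = P(PD)`:
`Z = D · ( W [(g_l − s_H) + (g_h − s_L^h)] + gap · s_L^h − r_b (s_H − s_L3) − r_b^h (s_L^h − s_H3^h) )`. -/
theorem Z_six_bracket (p : E → R) (ends : E → Sym2 V) (o a₁ a₂ a₃ b : V)
    (hN : Nh p ends a₁ a₂ a₃ b ≠ 0) (hr : rb p ends a₁ a₂ a₃ b ≠ 0)
    (hNh : Nh p ends a₂ a₁ a₃ b ≠ 0) (hrh : rb p ends a₂ a₁ a₃ b ≠ 0)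
    (hD : prob p (PDEvent ends a₁ a₂ a₃) ≠ 0) :
    (prob p (PDEvent ends a₁ a₂ a₃ ∩ connEvent ends a₁ o) +
          prob p (PDEvent ends a₁ a₂ a₃ ∩ connEvent ends a₂ o)) *
        (massM2 p ends a₁ a₂ a₃ b + deltaT p ends a₁ a₂ a₃ b) -
      ((prob p (PDEvent ends a₁ a₂ a₃ ∩ connEvent ends a₁ o ∩ connEvent ends a₂ b) -
            deltaL p ends o a₁ a₂ a₃ b) +
          (prob p (PDEvent ends a₁ a₂ a₃ ∩ connEvent ends a₂ o ∩ connEvent ends a₁ b) -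
            deltaH p ends o a₁ a₂ a₃ b)) * prob p (PDEvent ends a₁ a₂ a₃) =
      prob p (PDEvent ends a₁ a₂ a₃) *
        ((massM2 p ends a₁ a₂ a₃ b + deltaT p ends a₁ a₂ a₃ b) *
            ((gl p ends o a₁ a₂ a₃ - shareH p ends o a₁ a₂ a₃ b) +
              (gl p ends o a₂ a₁ a₃ - shareH p ends o a₂ a₁ a₃ b)) +
          (prob p (connEvent ends a₂ b) - prob p (connEvent ends a₁ b)) *
            shareH p ends o a₂ a₁ a₃ b -
          rb p ends a₁ a₂ a₃ b * (shareH p ends o a₁ a₂ a₃ b - shareL3 p ends o a₁ a₂ a₃ b) -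
          rb p ends a₂ a₁ a₃ b * (shareH p ends o a₂ a₁ a₃ b - shareL3 p ends o a₂ a₁ a₃ b)) := by
  -- the masses in the threshold vocabulary
  rw [Tlh_sub_deltaL_eq, Thl_sub_deltaH_eq]
  have hW := W_eq_Nh_sub_rb p ends a₁ a₂ a₃ b
  have hWh : Wh p ends a₁ a₂ a₃ b = Nh p ends a₂ a₁ a₃ b - rb p ends a₂ a₁ a₃ b :=
    W_eq_Nh_sub_rb p ends a₂ a₁ a₃ b
  have hgap := gap_eq p ends a₁ a₂ a₃ b
  rw [hWh] at hgap
  rw [← hgap, hW]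
  unfold gl shareH shareL3
  rw [PDEvent_symm ends a₁ a₂ a₃]
  field_simp
  ring

end SixBracket

section TwoRootDecomposition

variable {V : Type*} {E : Type*} [Fintype E] [DecidableEq E] [Fintype V] [DecidableEq V]
  {R : Type*} [Field R] [LinearOrder R] [IsStrictOrderedRing R]

omit [LinearOrder R] [IsStrictOrderedRing R] in
/-- **The two-root covariance expansion of `Z`**, cleared by `P(R) · P(R_h)`:
`Z · P(R) P(R_h) = P(R_h) · [bracket_l + (D − W)(P(R) A′ − O_l r_b)]
                 + P(R) · [bracket_h + (D − W_h)(P(R_h) A′_h − O_h r_b^h)] + D_h · gap · P(R) P(R_h)`,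
where `bracket_x = E[1_o τ₀^x; R_x] P(R_x) − E[1_o; R_x] E[τ₀^x; R_x]` (`LambdaSlack.bracket_nonneg`),
`O_x = E[1_o; R_x]`, `A′_x = E[1_o 1_b (1 − u_x); R_x]`, `r_x = E[1_b (1 − u_x); R_x]`. -/
theorem Z_two_root_decomp (p : E → R) (ends : E → Sym2 V) (o a₁ a₂ a₃ b : V) :
    ((prob p (PDEvent ends a₁ a₂ a₃ ∩ connEvent ends a₁ o) +
          prob p (PDEvent ends a₁ a₂ a₃ ∩ connEvent ends a₂ o)) *
        (massM2 p ends a₁ a₂ a₃ b + deltaT p ends a₁ a₂ a₃ b) -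
      ((prob p (PDEvent ends a₁ a₂ a₃ ∩ connEvent ends a₁ o ∩ connEvent ends a₂ b) -
            deltaL p ends o a₁ a₂ a₃ b) +
          (prob p (PDEvent ends a₁ a₂ a₃ ∩ connEvent ends a₂ o ∩ connEvent ends a₁ b) -
            deltaH p ends o a₁ a₂ a₃ b)) * prob p (PDEvent ends a₁ a₂ a₃)) *
        (prob p (avoidAll ends a₁ {a₂, a₃}) * prob p (avoidAll ends a₂ {a₁, a₃})) =
      prob p (avoidAll ends a₂ {a₁, a₃}) *
          ((expect p (fun ω => ind o (cluster ends ω a₁) *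
                Lambda.tau0 p ends a₁ a₂ a₃ b (cluster ends ω a₁) *
                (avoidAll ends a₁ {a₂, a₃}).indicator 1 ω) * prob p (avoidAll ends a₁ {a₂, a₃}) -
              expect p (fun ω => ind o (cluster ends ω a₁) * (avoidAll ends a₁ {a₂, a₃}).indicator 1 ω) *
                expect p (fun ω => Lambda.tau0 p ends a₁ a₂ a₃ b (cluster ends ω a₁) *
                  (avoidAll ends a₁ {a₂, a₃}).indicator 1 ω)) +
            (prob p (PDEvent ends a₁ a₂ a₃) - (massM2 p ends a₁ a₂ a₃ b + deltaT p ends a₁ a₂ a₃ b)) *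
              (prob p (avoidAll ends a₁ {a₂, a₃}) *
                  expect p (fun ω => ind o (cluster ends ω a₁) * (ind b (cluster ends ω a₁) *
                    (1 - u p ends a₂ a₃ (cluster ends ω a₁))) *
                    (avoidAll ends a₁ {a₂, a₃}).indicator 1 ω) -
                expect p (fun ω => ind o (cluster ends ω a₁) * (avoidAll ends a₁ {a₂, a₃}).indicator 1 ω) *
                  expect p (fun ω => ind b (cluster ends ω a₁) *
                    (1 - u p ends a₂ a₃ (cluster ends ω a₁)) *
                    (avoidAll ends a₁ {a₂, a₃}).indicator 1 ω))) +
        prob p (avoidAll ends a₁ {a₂, a₃}) *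
          ((expect p (fun ω => ind o (cluster ends ω a₂) *
                Lambda.tau0 p ends a₂ a₁ a₃ b (cluster ends ω a₂) *
                (avoidAll ends a₂ {a₁, a₃}).indicator 1 ω) * prob p (avoidAll ends a₂ {a₁, a₃}) -
              expect p (fun ω => ind o (cluster ends ω a₂) * (avoidAll ends a₂ {a₁, a₃}).indicator 1 ω) *
                expect p (fun ω => Lambda.tau0 p ends a₂ a₁ a₃ b (cluster ends ω a₂) *
                  (avoidAll ends a₂ {a₁, a₃}).indicator 1 ω)) +
            (prob p (PDEvent ends a₁ a₂ a₃) - Wh p ends a₁ a₂ a₃ b) *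
              (prob p (avoidAll ends a₂ {a₁, a₃}) *
                  expect p (fun ω => ind o (cluster ends ω a₂) * (ind b (cluster ends ω a₂) *
                    (1 - u p ends a₁ a₃ (cluster ends ω a₂))) *
                    (avoidAll ends a₂ {a₁, a₃}).indicator 1 ω) -
                expect p (fun ω => ind o (cluster ends ω a₂) * (avoidAll ends a₂ {a₁, a₃}).indicator 1 ω) *
                  expect p (fun ω => ind b (cluster ends ω a₂) *
                    (1 - u p ends a₁ a₃ (cluster ends ω a₂)) *
                    (avoidAll ends a₂ {a₁, a₃}).indicator 1 ω))) +
        prob p (PDEvent ends a₁ a₂ a₃ ∩ connEvent ends a₂ o) *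
          (prob p (connEvent ends a₂ b) - prob p (connEvent ends a₁ b)) *
          (prob p (avoidAll ends a₁ {a₂, a₃}) * prob p (avoidAll ends a₂ {a₁, a₃})) := by
  rw [Z_identity p ends o a₁ a₂ a₃ b]
  have hl := Lambda.slack_decomp p ends a₁ a₂ a₃ b (fun ω => ind o (cluster ends ω a₁))
  have hh := Lambda.slack_decomp p ends a₂ a₁ a₃ b (fun ω => ind o (cluster ends ω a₂))
  rw [PDEvent_symm] at hh
  unfold Wh
  rw [add_mul, add_mul, mul_assoc, ← mul_assoc _ (prob p (avoidAll ends a₁ {a₂, a₃})), hl]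
  rw [mul_comm (prob p (avoidAll ends a₁ {a₂, a₃})) (prob p (avoidAll ends a₂ {a₁, a₃})),
    ← mul_assoc (expect p fun ω => ind o (cluster ends ω a₂) * _ * _), hh]
  ring

end TwoRootDecomposition

section LocationCut

variable {V : Type*} {E : Type*} [Fintype E] [DecidableEq E] [Fintype V] [DecidableEq V]
  {R : Type*} [Field R] [LinearOrder R] [IsStrictOrderedRing R]

/-- `Z_0` (PD-world, ADDENDUM 17 (6)): `D_o · P(PD, b ∈ C₂) − D · [P(PD, o ∈ C₁, b ∈ C₂) + P(PD, o ∈ C₂, b ∈ C₁)]`,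
`D_o = P(PD, o ∈ C₁) + P(PD, o ∈ C₂)`. -/
noncomputable def Z0 (p : E → R) (ends : E → Sym2 V) (o a₁ a₂ a₃ b : V) : R :=
  (prob p (PDEvent ends a₁ a₂ a₃ ∩ connEvent ends a₁ o) +
      prob p (PDEvent ends a₁ a₂ a₃ ∩ connEvent ends a₂ o)) * massM2 p ends a₁ a₂ a₃ b -
    prob p (PDEvent ends a₁ a₂ a₃) *
      (prob p (PDEvent ends a₁ a₂ a₃ ∩ connEvent ends a₁ o ∩ connEvent ends a₂ b) +
        prob p (PDEvent ends a₁ a₂ a₃ ∩ connEvent ends a₂ o ∩ connEvent ends a₁ b))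

/-- `Z_h` (T-world): `D_o · Δ_T − D · Δ_T^o`, `Δ_T^o = P(T, o ∈ C₁, b ∈ C₂) − P(T, o ∈ C₁, b ∈ C₁)`. -/
noncomputable def Zh (p : E → R) (ends : E → Sym2 V) (o a₁ a₂ a₃ b : V) : R :=
  (prob p (PDEvent ends a₁ a₂ a₃ ∩ connEvent ends a₁ o) +
      prob p (PDEvent ends a₁ a₂ a₃ ∩ connEvent ends a₂ o)) * deltaT p ends a₁ a₂ a₃ b -
    prob p (PDEvent ends a₁ a₂ a₃) *
      (prob p (TEvent ends a₁ a₂ a₃ ∩ connEvent ends a₁ o ∩ connEvent ends a₂ b) -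
        prob p (TEvent ends a₁ a₂ a₃ ∩ connEvent ends a₁ o ∩ connEvent ends a₁ b))

/-- `Z_l` (T′-world): `−D · [P(T′, o ∈ C₂, b ∈ C₁) − P(T′, o ∈ C₂, b ∈ C₂)]`. -/
noncomputable def Zl (p : E → R) (ends : E → Sym2 V) (o a₁ a₂ a₃ b : V) : R :=
  -(prob p (PDEvent ends a₁ a₂ a₃) *
      (prob p (TEvent ends a₂ a₁ a₃ ∩ connEvent ends a₂ o ∩ connEvent ends a₁ b) -
        prob p (TEvent ends a₂ a₁ a₃ ∩ connEvent ends a₂ o ∩ connEvent ends a₂ b)))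

omit [Fintype V] [DecidableEq V] [LinearOrder R] [IsStrictOrderedRing R] in
/-- **The a₃-location cut** (ADDENDUM 17 (6)): `Z = Z_0 + Z_h + Z_l` (a regrouping of the terms of
`Z` by the world `a₃ ∉ C₁ ∪ C₂` / `a₃ ∈ C₂` / `a₃ ∈ C₁`). -/
theorem Z_location_cut (p : E → R) (ends : E → Sym2 V) (o a₁ a₂ a₃ b : V) :
    (prob p (PDEvent ends a₁ a₂ a₃ ∩ connEvent ends a₁ o) +
          prob p (PDEvent ends a₁ a₂ a₃ ∩ connEvent ends a₂ o)) *
        (massM2 p ends a₁ a₂ a₃ b + deltaT p ends a₁ a₂ a₃ b) -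
      ((prob p (PDEvent ends a₁ a₂ a₃ ∩ connEvent ends a₁ o ∩ connEvent ends a₂ b) -
            deltaL p ends o a₁ a₂ a₃ b) +
          (prob p (PDEvent ends a₁ a₂ a₃ ∩ connEvent ends a₂ o ∩ connEvent ends a₁ b) -
            deltaH p ends o a₁ a₂ a₃ b)) * prob p (PDEvent ends a₁ a₂ a₃) =
      Z0 p ends o a₁ a₂ a₃ b + Zh p ends o a₁ a₂ a₃ b + Zl p ends o a₁ a₂ a₃ b := by
  unfold Z0 Zh Zl deltaL deltaH
  ring

/-- `Z_0a` (PD-world, light): `D_l · P(PD, b ∈ C₂) − D · P(PD, o ∈ C₁, b ∈ C₂)` (the PD-world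
correlation of `{o ∈ C₁}` and `{b ∈ C₂}`; FALSE as a row, ADDENDUM 17 (6)). -/
noncomputable def Z0a (p : E → R) (ends : E → Sym2 V) (o a₁ a₂ a₃ b : V) : R :=
  prob p (PDEvent ends a₁ a₂ a₃ ∩ connEvent ends a₁ o) * massM2 p ends a₁ a₂ a₃ b -
    prob p (PDEvent ends a₁ a₂ a₃) *
      prob p (PDEvent ends a₁ a₂ a₃ ∩ connEvent ends a₁ o ∩ connEvent ends a₂ b)

/-- `Z_h′` (T-world, light): `D_l · Δ_T − D · Δ_T^o` — "the `o ∈ C₁`-share of the order margin is at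
most `g_l`" (0 at n = 5, NEGATIVE at the NEG-32 points). -/
noncomputable def ZhPrime (p : E → R) (ends : E → Sym2 V) (o a₁ a₂ a₃ b : V) : R :=
  prob p (PDEvent ends a₁ a₂ a₃ ∩ connEvent ends a₁ o) * deltaT p ends a₁ a₂ a₃ b -
    prob p (PDEvent ends a₁ a₂ a₃) *
      (prob p (TEvent ends a₁ a₂ a₃ ∩ connEvent ends a₁ o ∩ connEvent ends a₂ b) -
        prob p (TEvent ends a₁ a₂ a₃ ∩ connEvent ends a₁ o ∩ connEvent ends a₁ b))

/-- `ZL := Z_0 + Z_l + D_h · Δ_T` (the census row "Z_0 + Z_l + D_h·Δ_T", 0 at n = 5). -/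
noncomputable def ZL (p : E → R) (ends : E → Sym2 V) (o a₁ a₂ a₃ b : V) : R :=
  Z0 p ends o a₁ a₂ a₃ b + Zl p ends o a₁ a₂ a₃ b +
    prob p (PDEvent ends a₁ a₂ a₃ ∩ connEvent ends a₂ o) * deltaT p ends a₁ a₂ a₃ b

omit [Fintype V] [DecidableEq V] [LinearOrder R] [IsStrictOrderedRing R] in
/-- `σ_l = (Yu1Δ)-slack = Z_0a + Z_h′` (ADDENDUM 17 (6)). -/
theorem sigma_light_eq (p : E → R) (ends : E → Sym2 V) (o a₁ a₂ a₃ b : V) :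
    prob p (PDEvent ends a₁ a₂ a₃ ∩ connEvent ends a₁ o) *
          (massM2 p ends a₁ a₂ a₃ b + deltaT p ends a₁ a₂ a₃ b) +
        deltaL p ends o a₁ a₂ a₃ b * prob p (PDEvent ends a₁ a₂ a₃) -
      prob p (PDEvent ends a₁ a₂ a₃ ∩ connEvent ends a₁ o ∩ connEvent ends a₂ b) *
        prob p (PDEvent ends a₁ a₂ a₃) =
      Z0a p ends o a₁ a₂ a₃ b + ZhPrime p ends o a₁ a₂ a₃ b := by
  unfold Z0a ZhPrime deltaL
  ring

omit [Fintype V] [DecidableEq V] [LinearOrder R] [IsStrictOrderedRing R] in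
/-- `Z = ZL + Z_h′ + Z_0 − Z_0 …`: precisely, `Z = ZL + (Z_h − D_h · Δ_T)` and `Z_h − D_h Δ_T = Z_h′`,
so `Z = ZL + Z_h′`. -/
theorem Z_eq_ZL_add_ZhPrime (p : E → R) (ends : E → Sym2 V) (o a₁ a₂ a₃ b : V) :
    Z0 p ends o a₁ a₂ a₃ b + Zh p ends o a₁ a₂ a₃ b + Zl p ends o a₁ a₂ a₃ b =
      ZL p ends o a₁ a₂ a₃ b + ZhPrime p ends o a₁ a₂ a₃ b := by
  unfold ZL Zh ZhPrime
  ring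

/-- **Row 2′Zh** (CONJECTURES v2.55, support row): `Z_h ≥ 0`, i.e. `Δ_T^o / Δ_T ≤ g_l + g_h` — the
`o ∈ C₁`-share of the order margin is at most the PD-share of `o` in the two root clusters
(census-clean, hypothesis-free, n ≤ 7: 0 / 44.9M). -/
def ZhNonneg (p : E → R) (ends : E → Sym2 V) (o a₁ a₂ a₃ b : V) : Prop :=
  0 ≤ Zh p ends o a₁ a₂ a₃ b

/-- **`Z_0 + Z_h ≥ 0`** (census-clean, hypothesis-free, n ≤ 7: 0 / 44.9M) — if it survives, the only
burden of (ZΔ) is the T′-world piece `Z_l`. -/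
def Z0ZhNonneg (p : E → R) (ends : E → Sym2 V) (o a₁ a₂ a₃ b : V) : Prop :=
  0 ≤ Z0 p ends o a₁ a₂ a₃ b + Zh p ends o a₁ a₂ a₃ b

/-- `Yh := D_h · W − D · P(PD, o ∈ C₂, b ∈ C₁)` (ADDENDUM 17 (11)(b): `Yh ≥ 0 ⟺ P(b ∈ C₁ | PD, o ∈ C₂) ≤ W/D`;
candidate splitter of `Z_0 + Z_h = σ_l + Yh`). -/
noncomputable def Yh (p : E → R) (ends : E → Sym2 V) (o a₁ a₂ a₃ b : V) : R :=
  prob p (PDEvent ends a₁ a₂ a₃ ∩ connEvent ends a₂ o) *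
      (massM2 p ends a₁ a₂ a₃ b + deltaT p ends a₁ a₂ a₃ b) -
    prob p (PDEvent ends a₁ a₂ a₃) *
      prob p (PDEvent ends a₁ a₂ a₃ ∩ connEvent ends a₂ o ∩ connEvent ends a₁ b)

/-- `Yh ≥ 0` — this is **(Yu2)** (`T_{h→l} · P(PD) ≤ P(PD, o ∈ C₂) · W`, p1's `yu2_cleared`, a
THEOREM under the labelling; lead 00:32:32Z). -/
def YhNonneg (p : E → R) (ends : E → Sym2 V) (o a₁ a₂ a₃ b : V) : Prop :=
  0 ≤ Yh p ends o a₁ a₂ a₃ b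

/-- **`Yh ≥ 0` is a theorem under the labelling** (= (Yu2), `yu2_cleared`). -/
theorem Yh_nonneg_of_order (p : E → R) (hp : IsProbVec p) (ends : E → Sym2 V) {o a₁ a₂ a₃ b : V}
    (hord : prob p (connEvent ends a₁ b) ≤ prob p (connEvent ends a₂ b)) :
    YhNonneg p ends o a₁ a₂ a₃ b := by
  unfold YhNonneg Yh
  have := yu2_cleared p hp ends (o := o) (a₃ := a₃) hord
  linarith

omit [Fintype V] [DecidableEq V] [LinearOrder R] [IsStrictOrderedRing R] in
/-- `Z_l = D · Δ_h` (the T′-world burden is `D` times the heavy `Δ_h`). -/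
theorem Zl_eq_deltaH (p : E → R) (ends : E → Sym2 V) (o a₁ a₂ a₃ b : V) :
    Zl p ends o a₁ a₂ a₃ b = prob p (PDEvent ends a₁ a₂ a₃) * deltaH p ends o a₁ a₂ a₃ b := by
  unfold Zl deltaH
  ring

omit [Fintype V] [DecidableEq V] [LinearOrder R] [IsStrictOrderedRing R] in
/-- **`Z_0 + Z_h = σ_l + Yh`** (ADDENDUM 17 (11)(b)): the L2 rung is the light root's own slack plus
`Yh`. -/
theorem Z0Zh_eq_sigma_add_Yh (p : E → R) (ends : E → Sym2 V) (o a₁ a₂ a₃ b : V) :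
    Z0 p ends o a₁ a₂ a₃ b + Zh p ends o a₁ a₂ a₃ b =
      (prob p (PDEvent ends a₁ a₂ a₃ ∩ connEvent ends a₁ o) *
            (massM2 p ends a₁ a₂ a₃ b + deltaT p ends a₁ a₂ a₃ b) +
          deltaL p ends o a₁ a₂ a₃ b * prob p (PDEvent ends a₁ a₂ a₃) -
        prob p (PDEvent ends a₁ a₂ a₃ ∩ connEvent ends a₁ o ∩ connEvent ends a₂ b) *
          prob p (PDEvent ends a₁ a₂ a₃)) +
      Yh p ends o a₁ a₂ a₃ b := by
  unfold Z0 Zh Yh deltaL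
  ring

omit [Fintype V] [DecidableEq V] in
/-- **L2 in Lean-ready form** (ADDENDUM 17 (11)(e)): `Z_0 + Z_h ≥ 0 ⟺ D_o · W ≥ D · [T_{l→h} + T_{h→l} + Δ_T^o]`. -/
theorem Z0ZhNonneg_iff (p : E → R) (ends : E → Sym2 V) (o a₁ a₂ a₃ b : V) :
    Z0ZhNonneg p ends o a₁ a₂ a₃ b ↔
      prob p (PDEvent ends a₁ a₂ a₃) *
          (prob p (PDEvent ends a₁ a₂ a₃ ∩ connEvent ends a₁ o ∩ connEvent ends a₂ b) +
            prob p (PDEvent ends a₁ a₂ a₃ ∩ connEvent ends a₂ o ∩ connEvent ends a₁ b) +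
            (prob p (TEvent ends a₁ a₂ a₃ ∩ connEvent ends a₁ o ∩ connEvent ends a₂ b) -
              prob p (TEvent ends a₁ a₂ a₃ ∩ connEvent ends a₁ o ∩ connEvent ends a₁ b))) ≤
        (prob p (PDEvent ends a₁ a₂ a₃ ∩ connEvent ends a₁ o) +
            prob p (PDEvent ends a₁ a₂ a₃ ∩ connEvent ends a₂ o)) *
          (massM2 p ends a₁ a₂ a₃ b + deltaT p ends a₁ a₂ a₃ b) := by
  unfold Z0ZhNonneg Z0 Zh
  constructor
  · intro h
    linarith
  · intro h
    linarith

omit [Fintype V] [DecidableEq V] [LinearOrder R] [IsStrictOrderedRing R] in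
/-- **`Z = (Z_0 + Z_h) + D · Δ_h`** (ADDENDUM 17 (11)(e): the crux is the L2 rung plus the T′-world
burden). -/
theorem Z_eq_Z0h_add_deltaH (p : E → R) (ends : E → Sym2 V) (o a₁ a₂ a₃ b : V) :
    (prob p (PDEvent ends a₁ a₂ a₃ ∩ connEvent ends a₁ o) +
          prob p (PDEvent ends a₁ a₂ a₃ ∩ connEvent ends a₂ o)) *
        (massM2 p ends a₁ a₂ a₃ b + deltaT p ends a₁ a₂ a₃ b) -
      ((prob p (PDEvent ends a₁ a₂ a₃ ∩ connEvent ends a₁ o ∩ connEvent ends a₂ b) -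
            deltaL p ends o a₁ a₂ a₃ b) +
          (prob p (PDEvent ends a₁ a₂ a₃ ∩ connEvent ends a₂ o ∩ connEvent ends a₁ b) -
            deltaH p ends o a₁ a₂ a₃ b)) * prob p (PDEvent ends a₁ a₂ a₃) =
      (Z0 p ends o a₁ a₂ a₃ b + Zh p ends o a₁ a₂ a₃ b) +
        prob p (PDEvent ends a₁ a₂ a₃) * deltaH p ends o a₁ a₂ a₃ b := by
  rw [Z_location_cut, Zl_eq_deltaH]

/-- **L2 from (Yu1Δ)** under the labelling: `Z_0 + Z_h = σ_l + Yh ≥ 0` when `σ_l ≥ 0` (the light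
root's own slack; NEG-32 says it can fail, so this is NOT a proof of L2 — it records that L2 is
exactly "σ_l ≥ −Yh"). -/
theorem Z0ZhNonneg_of_Yu1Delta (p : E → R) (hp : IsProbVec p) (ends : E → Sym2 V)
    {o a₁ a₂ a₃ b : V} (hord : prob p (connEvent ends a₁ b) ≤ prob p (connEvent ends a₂ b))
    (h1 : Yu1Delta p ends o a₁ a₂ a₃ b) : Z0ZhNonneg p ends o a₁ a₂ a₃ b := by
  unfold Z0ZhNonneg
  rw [Z0Zh_eq_sigma_add_Yh]
  have hY := Yh_nonneg_of_order p hp ends (o := o) (a₃ := a₃) hord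
  unfold YhNonneg at hY
  unfold Yu1Delta at h1
  linarith

omit [Fintype V] [DecidableEq V] in
/-- `(ZΔ)` from `Z_0 + Z_h ≥ 0` and `Z_l ≥ 0` (the location cut). -/
theorem ZDelta_of_Z0Zh_Zl (p : E → R) (ends : E → Sym2 V) {o a₁ a₂ a₃ b : V}
    (h0h : Z0ZhNonneg p ends o a₁ a₂ a₃ b) (hl : 0 ≤ Zl p ends o a₁ a₂ a₃ b) :
    ZDelta p ends o a₁ a₂ a₃ b := by
  unfold ZDelta
  have e := Z_location_cut p ends o a₁ a₂ a₃ b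
  unfold Z0ZhNonneg at h0h
  linarith

end LocationCut

section LocationClosures

variable (R : Type*) [Field R] [LinearOrder R] [IsStrictOrderedRing R]

/-- **Row 2′Zh for every finite graph**, hypothesis-free. -/
def ZhNonneg_all : Prop :=
  ∀ (V E : Type) [Fintype V] [DecidableEq V] [Fintype E] [DecidableEq E]
    (ends : E → Sym2 V) (p : E → R), IsProbVec p →
    ∀ o a₁ a₂ a₃ b : V, a₁ ≠ a₂ → a₁ ≠ a₃ → a₂ ≠ a₃ → o ≠ a₁ → o ≠ a₂ → o ≠ a₃ → o ≠ b →
      b ≠ a₁ → b ≠ a₂ → b ≠ a₃ → ZhNonneg p ends o a₁ a₂ a₃ b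

/-- **`Z_0 + Z_h ≥ 0` for every finite graph**, hypothesis-free. -/
def Z0ZhNonneg_all : Prop :=
  ∀ (V E : Type) [Fintype V] [DecidableEq V] [Fintype E] [DecidableEq E]
    (ends : E → Sym2 V) (p : E → R), IsProbVec p →
    ∀ o a₁ a₂ a₃ b : V, a₁ ≠ a₂ → a₁ ≠ a₃ → a₂ ≠ a₃ → o ≠ a₁ → o ≠ a₂ → o ≠ a₃ → o ≠ b →
      b ≠ a₁ → b ≠ a₂ → b ≠ a₃ → Z0ZhNonneg p ends o a₁ a₂ a₃ b

end LocationClosures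

end Summit.Ventures.PercRepro2
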